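import Literature.Computability.AlgebraicComplexity.StrongUSP

/-!
# ω-census, family (b1): the tiling lemma for (weak) USPs and a verified USP checker, kernel-evaluable

HONEST FRAMING (pub-omega census; verbatim): lottery ticket; floor = certified bounds/negative ranges.
Census BOOKKEEPING for the (size, width) table of uniquely solvable puzzles (CKSU 2005 §3, "at least two");
plain USPs carry no bound on `ω`; nothing here touches `ω`.

`IsUSP row` quantifies over three permutations of the `s` rows; `decide` on it is out of reach beyond `s = 4`,
and the tree's kernel witnesses so far (`isUSP_14_5`, `isUSP_21_6`, `isUSP_28_7`, file `USPTriangular`) are all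
TRIANGULAR puzzles (`isUSP_of_triLoud`).  This file certifies arbitrary USPs:

* `isUSP_iff_fix_first` — WLOG `π₁ = 1` (as for strong USPs, `isStrongUSP_iff_fix_first`).
* **Tiling lemma** `IsUSP.cover_of_quiet`: if `(1, π₂, π₃)` is QUIET (no cell `(u, i)` has two of
  `row u i = 1`, `row (π₂ u) i = 2`, `row (π₃ u) i = 3`), then every cell has AT LEAST ONE of them: the
  `1`-piece of `u`, the `2`-piece of `π₂ u` and the `3`-piece of `π₃ u` tile the `k` columns exactly.  Proof:
  count the incidences; re-indexing by `π₂`, `π₃` shows they total `s · k`, and quietness caps each cell at one.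
  Consequence: in a reassembly the `3`-piece is FORCED by the other two, so the search below only branches over
  tiling triples (a handful per row) instead of all quiet ones.
* `uspSearch` / `uspCheck row ord` — structurally recursive exhaustive search over partial TILING 3D matchings
  along a caller-chosen row order `ord` (any nodup list covering all rows; the order only affects kernel time —
  a frontier-greedy order keeps the instances below under 10³ search nodes), and
  `isUSP_of_uspCheck : uspCheck row ord = true → IsUSP row` (soundness, by the invariant `uspSearch_sound`,
  the exact analogue of `suspSearch_sound` in `StrongUSPCheck`).
* Instances: USPs of width 6 with 25 rows (`isUSP_25_6`) and width 7 with 37 rows (`isUSP_37_7`) found by the STPP-track engine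
  (`run/shared/lean/pub/pub-omega/pub-omega-stpp-1-g7/`, simulated annealing on the tiling-lemma verifier),
  improving the kernel lower halves `21` (`isUSP_21_6`) and `28` (`isUSP_28_7`) of the census cells (engine-level: 38 rows at width 7)
  `s_max^USP(6) ∈ [21, 30]`, `s_max^USP(7) ∈ [28, 55]` (`USPPieceCountBound`).  Not in print (Anderson–Ji–Xu
  tabulate STRONG USPs only).

References: Cohn–Kleinberg–Szegedy–Umans, FOCS 2005 (arXiv:math/0511460) §3 (USP definition, puzzle
interpretation); Anderson–Ji–Xu, SAT 2020 / arXiv:2301.00074 §3.1 (π₁ = 1; 3D-matching formulation).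
-/

namespace Summit.MatrixMultiplication.OmegaCensus

open Literature.Computability.AlgebraicComplexity Equiv

variable {s k : ℕ}

/-! ## WLOG `π₁ = 1` -/

/-- **WLOG `π₁ = 1`** for (weak) USPs: the USP condition for `(π₁, π₂, π₃)` is the condition for
`(1, π₂ π₁⁻¹, π₃ π₁⁻¹)` after re-indexing `u ↦ π₁ u` (verbatim the strong-USP reduction
`isStrongUSP_iff_fix_first`). [cite: AndersonJiXu2020, §3.1 (Algorithm 1: "we fix π₁ = 1"; arXiv:2301.00074v1)] -/
theorem isUSP_iff_fix_first (row : Fin s → Fin k → Fin 3) :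
    IsUSP row ↔ ∀ π₂ π₃ : Perm (Fin s), (π₂ = 1 ∧ π₃ = 1) ∨
      ∃ u : Fin s, ∃ i : Fin k, USPAtLeastTwo (row u i) (row (π₂ u) i) (row (π₃ u) i) := by
  constructor
  · intro h π₂ π₃
    rcases h 1 π₂ π₃ with ⟨h12, h23⟩ | ⟨u, i, hx⟩
    · exact Or.inl ⟨h12.symm, (h12.trans h23).symm⟩
    · exact Or.inr ⟨u, i, by simpa using hx⟩
  · intro h π₁ π₂ π₃
    rcases h (π₂ * π₁⁻¹) (π₃ * π₁⁻¹) with ⟨h2, h3⟩ | ⟨u, i, hx⟩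
    · left
      rw [mul_inv_eq_one] at h2 h3
      exact ⟨h2.symm, h2.trans h3.symm⟩
    · right
      refine ⟨π₁⁻¹ u, i, ?_⟩
      simpa [Perm.mul_apply] using hx

/-! ## The tiling lemma -/

/-- Number of the events `a = 1`, `b = 2`, `c = 3` (symbols coded `0, 1, 2`) that hold for a symbol triple. [folklore] -/
def uspCnt (a b c : Fin 3) : ℕ :=
  (if a = 0 then 1 else 0) + (if b = 1 then 1 else 0) + (if c = 2 then 1 else 0)

/-- A quiet cell (fewer than two of the events) has count at most one. [folklore] -/
private theorem uspCnt_le_one_of_not_atLeastTwo {a b c : Fin 3} (h : ¬ USPAtLeastTwo a b c) :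
    uspCnt a b c ≤ 1 := by
  revert a b c; unfold uspCnt USPAtLeastTwo; decide

/-- A cell with none of the events has count zero. [folklore] -/
private theorem uspCnt_eq_zero {a b c : Fin 3} (h : ¬ (a = 0 ∨ b = 1 ∨ c = 2)) : uspCnt a b c = 0 := by
  revert a b c; unfold uspCnt; decide

/-- Every symbol is exactly one of `1, 2, 3`. [folklore] -/
private theorem ind_sum_eq_one (a : Fin 3) :
    (if a = 0 then 1 else 0) + (if a = 1 then 1 else 0) + (if a = 2 then 1 else 0) = 1 := by
  revert a; decide

/-- **Tiling lemma.** If no cell `(u, i)` has two of `row u i = 1`, `row (π₂ u) i = 2`, `row (π₃ u) i = 3`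
(the pair `(π₂, π₃)` is quiet against `π₁ = 1`), then EVERY cell has at least one of them: the `1`-piece of `u`,
the `2`-piece of `π₂ u` and the `3`-piece of `π₃ u` partition the columns.  (Counting: summed over all cells the
three indicator families total `s·k` after re-indexing rows by `π₂`, `π₃`; quietness caps each cell at one, so no
cell can have zero.)  This is the "pieces fit without overlap, hence exactly" reading of CKSU's jigsaw
interpretation of a USP. [cite: CohnKleinbergSzegedyUmans2005, §3 (p. 5), the puzzle interpretation of a USP] -/
theorem IsUSP.cover_of_quiet {row : Fin s → Fin k → Fin 3} (π₂ π₃ : Perm (Fin s))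
    (hq : ∀ u i, ¬ USPAtLeastTwo (row u i) (row (π₂ u) i) (row (π₃ u) i)) :
    ∀ u i, row u i = 0 ∨ row (π₂ u) i = 1 ∨ row (π₃ u) i = 2 := by
  classical
  -- the incidence count per cell
  set f : Fin s × Fin k → ℕ := fun x => uspCnt (row x.1 x.2) (row (π₂ x.1) x.2) (row (π₃ x.1) x.2) with hf
  have hle : ∀ x, f x ≤ 1 := fun x => uspCnt_le_one_of_not_atLeastTwo (hq x.1 x.2)
  -- total count = s * k, by re-indexing the second and third families
  have h2 : ∑ x : Fin s × Fin k, (if row (π₂ x.1) x.2 = 1 then 1 else 0)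
      = ∑ x : Fin s × Fin k, (if row x.1 x.2 = 1 then 1 else 0) :=
    Equiv.sum_comp (π₂.prodCongr (Equiv.refl (Fin k))) (fun x => if row x.1 x.2 = 1 then 1 else 0)
  have h3 : ∑ x : Fin s × Fin k, (if row (π₃ x.1) x.2 = 2 then 1 else 0)
      = ∑ x : Fin s × Fin k, (if row x.1 x.2 = 2 then 1 else 0) :=
    Equiv.sum_comp (π₃.prodCongr (Equiv.refl (Fin k))) (fun x => if row x.1 x.2 = 2 then 1 else 0)
  have htot : ∑ x : Fin s × Fin k, f x = ∑ x : Fin s × Fin k, 1 := by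
    have : ∑ x : Fin s × Fin k, f x = ∑ x : Fin s × Fin k, (if row x.1 x.2 = 0 then 1 else 0)
        + ∑ x : Fin s × Fin k, (if row (π₂ x.1) x.2 = 1 then 1 else 0)
        + ∑ x : Fin s × Fin k, (if row (π₃ x.1) x.2 = 2 then 1 else 0) := by
      rw [← Finset.sum_add_distrib, ← Finset.sum_add_distrib]; rfl
    rw [this, h2, h3, ← Finset.sum_add_distrib, ← Finset.sum_add_distrib]
    exact Finset.sum_congr rfl fun x _ => ind_sum_eq_one (row x.1 x.2)
  -- a cell with none of the events would make the total fall short by one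
  intro u i
  by_contra hnone
  have hz : f (u, i) = 0 := uspCnt_eq_zero hnone
  have hone : ∑ x : Fin s × Fin k, (if x = (u, i) then 1 else 0) = (1 : ℕ) := by
    rw [Finset.sum_ite_eq' Finset.univ (u, i) (fun _ => (1 : ℕ))]; simp
  have key : ∑ x : Fin s × Fin k, f x + 1 ≤ ∑ x : Fin s × Fin k, 1 :=
    calc ∑ x : Fin s × Fin k, f x + 1
        = ∑ x : Fin s × Fin k, f x + ∑ x : Fin s × Fin k, (if x = (u, i) then 1 else 0) := by rw [hone]
      _ = ∑ x : Fin s × Fin k, (f x + if x = (u, i) then 1 else 0) := Finset.sum_add_distrib.symm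
      _ ≤ ∑ x : Fin s × Fin k, 1 := Finset.sum_le_sum fun x _ => by
          by_cases hx : x = (u, i)
          · subst hx; rw [hz]; simp
          · rw [if_neg hx, Nat.add_zero]; exact hle x
  rw [htot] at key
  exact absurd key (Nat.not_succ_le_self _)

/-! ## The checker -/

/-- `1`-piece of `a` and `2`-piece of `b` are disjoint (cheap pre-filter of the search). [folklore] -/
def usp12 (row : Fin s → Fin k → Fin 3) (a b : Fin s) : Bool :=
  decide (∀ i : Fin k, ¬ (row a i = 0 ∧ row b i = 1))

/-- The ordered row triple `(a, b, c)` TILES: every column carries exactly one of `row a i = 1`, `row b i = 2`,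
`row c i = 3` (quiet AND covering). [cite: CohnKleinbergSzegedyUmans2005, §3 (p. 5), the puzzle interpretation of a USP] -/
def uspTiles (row : Fin s → Fin k → Fin 3) (a b c : Fin s) : Bool :=
  decide (∀ i : Fin k, ¬ USPAtLeastTwo (row a i) (row b i) (row c i) ∧ (row a i = 0 ∨ row b i = 1 ∨ row c i = 2))

/-- Exhaustive search over partial TILING 3D matchings (structural recursion on the rows still to be assigned):
`avS` / `avT` are the σ- / τ-images still available, `moved` records whether some assigned row `u` got
`(σ u, τ u) ≠ (u, u)`.  Value `true` iff every complete tiling assignment along this enumeration is the diagonal.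
[cite: AndersonJiXu2020, §3.1 (3D-matching formulation of USP verification)] -/
def uspSearch (row : Fin s → Fin k → Fin 3) : List (Fin s) → List (Fin s) → List (Fin s) → Bool → Bool
  | [], _, _, moved => !moved
  | u :: rest, avS, avT, moved =>
      avS.all fun b => !usp12 row u b || avT.all fun c =>
        !uspTiles row u b c || uspSearch row rest (avS.erase b) (avT.erase c) (moved || !(b == u && c == u))

/-- The checker: `ord` must list every row exactly once (checked), then the tiling search runs along `ord` with
all rows available as σ- and τ-images. [cite: AndersonJiXu2020, §3.1] -/
def uspCheck (row : Fin s → Fin k → Fin 3) (ord : List (Fin s)) : Bool :=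
  decide (ord.Nodup) && ((List.finRange s).all fun v => decide (v ∈ ord)) &&
    uspSearch row ord (List.finRange s) (List.finRange s) false

/-- **Invariant of the search.** If `(v, π₂ v, π₃ v)` tiles for every row, then along any branch that keeps
`π₂ v ∈ avS`, `π₃ v ∈ avT` for the unassigned rows, `uspSearch … moved = true` forces `moved = false` and
`π₂ v = v`, `π₃ v = v` on the unassigned rows. [folklore] -/
theorem uspSearch_sound {row : Fin s → Fin k → Fin 3} (π₂ π₃ : Perm (Fin s))
    (htl : ∀ v, uspTiles row v (π₂ v) (π₃ v) = true) :
    ∀ (rest avS avT : List (Fin s)) (moved : Bool), rest.Nodup →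
      (∀ v ∈ rest, π₂ v ∈ avS) → (∀ v ∈ rest, π₃ v ∈ avT) →
      uspSearch row rest avS avT moved = true →
      moved = false ∧ ∀ v ∈ rest, π₂ v = v ∧ π₃ v = v
  | [], avS, avT, moved, _, _, _, h => by
      refine ⟨by simpa [uspSearch] using h, ?_⟩
      intro v hv; simp at hv
  | u :: rest, avS, avT, moved, hnd, hS, hT, h => by
      rw [List.nodup_cons] at hnd
      obtain ⟨hu, hnd'⟩ := hnd
      simp only [uspSearch, List.all_eq_true, Bool.or_eq_true, Bool.not_eq_true'] at h
      have hb : π₂ u ∈ avS := hS u (List.mem_cons_self)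
      have hc : π₃ u ∈ avT := hT u (List.mem_cons_self)
      have h12 : usp12 row u (π₂ u) = true := by
        have := htl u
        simp only [uspTiles, usp12, decide_eq_true_eq] at this ⊢
        intro i ⟨h0, h1⟩
        exact (this i).1 (Or.inl ⟨h0, h1⟩)
      rcases h (π₂ u) hb with hn12 | hall
      · exact absurd h12 (by rw [hn12]; decide)
      rcases hall (π₃ u) hc with hnt | hrec
      · exact absurd (htl u) (by rw [hnt]; decide)
      · have hS' : ∀ v ∈ rest, π₂ v ∈ avS.erase (π₂ u) := fun v hv =>
          (List.mem_erase_of_ne (fun e => (ne_of_mem_of_not_mem hv hu) (π₂.injective e))).2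
            (hS v (List.mem_cons_of_mem u hv))
        have hT' : ∀ v ∈ rest, π₃ v ∈ avT.erase (π₃ u) := fun v hv =>
          (List.mem_erase_of_ne (fun e => (ne_of_mem_of_not_mem hv hu) (π₃.injective e))).2
            (hT v (List.mem_cons_of_mem u hv))
        obtain ⟨hm, hfix⟩ := uspSearch_sound π₂ π₃ htl rest _ _ _ hnd' hS' hT' hrec
        simp only [Bool.or_eq_false_iff, Bool.not_eq_eq_eq_not, Bool.not_false, Bool.and_eq_true,
          beq_iff_eq] at hm
        obtain ⟨hm0, hbu, hcu⟩ := hm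
        refine ⟨hm0, ?_⟩
        intro v hv
        rcases List.mem_cons.1 hv with rfl | hv'
        · exact ⟨hbu, hcu⟩
        · exact hfix v hv'

/-- **Soundness of the checker**: `uspCheck row ord = true` implies that `row` is a USP (CKSU 2005 §3, "at least
two"), for any row order `ord`.  (With `π₁ = 1` by `isUSP_iff_fix_first`: if no cell certifies `(π₂, π₃)`, the pair is
quiet, so by the tiling lemma every `(v, π₂ v, π₃ v)` tiles, and the invariant forces `π₂ = π₃ = 1`.)
[cite: CohnKleinbergSzegedyUmans2005, §3 (p. 5)] [cite: AndersonJiXu2020, §3.1] -/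
theorem isUSP_of_uspCheck {row : Fin s → Fin k → Fin 3} {ord : List (Fin s)}
    (h : uspCheck row ord = true) : IsUSP row := by
  rw [isUSP_iff_fix_first]
  intro π₂ π₃
  by_cases hex : ∃ u : Fin s, ∃ i : Fin k, USPAtLeastTwo (row u i) (row (π₂ u) i) (row (π₃ u) i)
  · exact Or.inr hex
  · left
    simp only [not_exists] at hex
    have hcov := IsUSP.cover_of_quiet (row := row) π₂ π₃ hex
    have htl : ∀ v, uspTiles row v (π₂ v) (π₃ v) = true := fun v => by
      simp only [uspTiles, decide_eq_true_eq]; exact fun i => ⟨hex v i, hcov v i⟩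
    simp only [uspCheck, Bool.and_eq_true, decide_eq_true_eq, List.all_eq_true] at h
    obtain ⟨⟨hnd, hcv⟩, hsearch⟩ := h
    have hcv' : ∀ v : Fin s, v ∈ ord := fun v => hcv v (List.mem_finRange v)
    obtain ⟨-, hfix⟩ := uspSearch_sound π₂ π₃ htl ord _ _ false hnd
      (fun v _ => List.mem_finRange _) (fun v _ => List.mem_finRange _) hsearch
    exact ⟨Equiv.ext fun v => (hfix v (hcv' v)).1, Equiv.ext fun v => (hfix v (hcv' v)).2⟩

/-! ## A USP of width 6 with 25 rows -/

/-- **A USP of width 6 with twenty-five rows** (rows as digit strings over `1,2,3`, coded `0,1,2` below):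
`{323133, 313333, 132231, 132312, 223233, 211212, 113212, 233313, 211123, 223331, 133121, 132113, 323112, 232211, 313213, 123322, 332121, 123123, 212131, 311223, 112322, 331322, 213231, 111332, 321212}` — found by simulated annealing on
the tiling-lemma verifier (`run/shared/lean/pub/pub-omega/pub-omega-stpp-1-g7/code/usp7.c`, mode `sa`, K = 6); NOT
triangular in any order the engine found, so it is certified by `uspCheck` along a frontier-greedy row order
(≈ 2.3·10³ search nodes).  Census cell: `25 ≤ s_max^USP(6) ≤ 30` (upper half `IsUSP.card_le_30_of_width_six`);
the previous kernel lower bound was `21` (`isUSP_21_6`).  Not in print. [cite: CohnKleinbergSzegedyUmans2005, §3 (p. 5), definition of a USP] -/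
theorem isUSP_25_6 : IsUSP ![![2, 1, 2, 0, 2, 2], ![2, 0, 2, 2, 2, 2], ![0, 2, 1, 1, 2, 0], ![0, 2, 1, 2, 0, 1], ![1, 1, 2, 1, 2, 2],
      ![1, 0, 0, 1, 0, 1], ![0, 0, 2, 1, 0, 1], ![1, 2, 2, 2, 0, 2], ![1, 0, 0, 0, 1, 2], ![1, 1, 2, 2, 2, 0],
      ![0, 2, 2, 0, 1, 0], ![0, 2, 1, 0, 0, 2], ![2, 1, 2, 0, 0, 1], ![1, 2, 1, 1, 0, 0], ![2, 0, 2, 1, 0, 2],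
      ![0, 1, 2, 2, 1, 1], ![2, 2, 1, 0, 1, 0], ![0, 1, 2, 0, 1, 2], ![1, 0, 1, 0, 2, 0], ![2, 0, 0, 1, 1, 2],
      ![0, 0, 1, 2, 1, 1], ![2, 2, 0, 2, 1, 1], ![1, 0, 2, 1, 2, 0], ![0, 0, 0, 2, 2, 1], ![2, 1, 0, 1, 0, 1]] :=
  isUSP_of_uspCheck (ord := [19, 21, 8, 5, 23, 24, 14, 6, 20, 1, 4, 22, 18, 7, 9, 12, 16, 13, 0, 11, 3, 15, 2, 10, 17]) (by decide +kernel)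

/-! ## A USP of width 7 with 37 rows -/

/-- **A USP of width 7 with thirty-seven rows** (rows as digit strings over `1,2,3`, coded `0,1,2` below):
`{1213133, 3311233, 2122131, 3221122, 1111122, 1223313, 1213223, 1332222, 3233212, 3121132, 3312213, 1123121, 3223232, 1231121, 2331312, 1333221, 1312321, 1323111, 1221332, 3311331, 1221123, 1232131, 3312221, 1122233, 3222113, 2213132, 2112311, 1321221, 2131321, 3131212, 2121333, 2313113, 3322132, 2332231, 3312333, 1133132, 2122323}` —
a sub-puzzle of a 38-row USP found by simulated annealing on the tiling-lemma verifier (same engine, K = 7; the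
38-row parent needs ≈ 10⁴ search nodes, beyond default heartbeats, and stays an engine-level object), certified by
`uspCheck` along a randomized frontier-greedy row order (≈ 1.1·10³ search nodes).  Census cell: `37 ≤ s_max^USP(7) ≤ 55`
in the kernel (upper half `IsUSP.card_le_55_of_width_seven`; engine lower bound 38); the previous kernel lower bound was
`28` (`isUSP_28_7`).  Not in print. [cite: CohnKleinbergSzegedyUmans2005, §3 (p. 5), definition of a USP] -/
theorem isUSP_37_7 : IsUSP ![![0, 1, 0, 2, 0, 2, 2], ![2, 2, 0, 0, 1, 2, 2], ![1, 0, 1, 1, 0, 2, 0], ![2, 1, 1, 0, 0, 1, 1], ![0, 0, 0, 0, 0, 1, 1],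
      ![0, 1, 1, 2, 2, 0, 2], ![0, 1, 0, 2, 1, 1, 2], ![0, 2, 2, 1, 1, 1, 1], ![2, 1, 2, 2, 1, 0, 1], ![2, 0, 1, 0, 0, 2, 1],
      ![2, 2, 0, 1, 1, 0, 2], ![0, 0, 1, 2, 0, 1, 0], ![2, 1, 1, 2, 1, 2, 1], ![0, 1, 2, 0, 0, 1, 0], ![1, 2, 2, 0, 2, 0, 1],
      ![0, 2, 2, 2, 1, 1, 0], ![0, 2, 0, 1, 2, 1, 0], ![0, 2, 1, 2, 0, 0, 0], ![0, 1, 1, 0, 2, 2, 1], ![2, 2, 0, 0, 2, 2, 0],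
      ![0, 1, 1, 0, 0, 1, 2], ![0, 1, 2, 1, 0, 2, 0], ![2, 2, 0, 1, 1, 1, 0], ![0, 0, 1, 1, 1, 2, 2], ![2, 1, 1, 1, 0, 0, 2],
      ![1, 1, 0, 2, 0, 2, 1], ![1, 0, 0, 1, 2, 0, 0], ![0, 2, 1, 0, 1, 1, 0], ![1, 0, 2, 0, 2, 1, 0], ![2, 0, 2, 0, 1, 0, 1],
      ![1, 0, 1, 0, 2, 2, 2], ![1, 2, 0, 2, 0, 0, 2], ![2, 2, 1, 1, 0, 2, 1], ![1, 2, 2, 1, 1, 2, 0], ![2, 2, 0, 1, 2, 2, 2],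
      ![0, 0, 2, 2, 0, 2, 1], ![1, 0, 1, 1, 2, 1, 2]] :=
  isUSP_of_uspCheck (ord := [10, 8, 22, 34, 30, 25, 24, 31, 29, 14, 28, 9, 36, 3, 12, 1, 19, 32, 33, 26, 18, 2, 5, 7, 6, 23, 4, 35, 0, 20, 16, 15, 27, 13, 17, 11, 21]) (by decide +kernel)

end Summit.MatrixMultiplication.OmegaCensus
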